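import Mathlib
import HarnessLib
import Literature.MathematicalPhysics.QuantumLattice.CloverPseudoscalar

/-!
# The Levi-Civita form of the clover charge density: `Σ_σ sgn(σ) Re tr(C_{σ₀σ₁}C_{σ₂σ₃}) = 8·(Re tr C₀₁C₂₃ − Re tr C₀₂C₁₃ + Re tr C₀₃C₁₂)`, so `−(1/32π²)·ε_{μνρσ} tr G_{μν}G_{ρσ} = −(1/4π²)·(three terms) = P_x/(8π²)`

HONEST FRAMING: exact (Metropolis-corrected) sampling algorithms for lattice gauge theory;
figures of merit are autocorrelation/cost numbers at stated couplings and volumes; no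
continuum-physics claim.

Venture `LatticeQCDFlow` (cell pub-lqcd), sub-topic `Scoring`, FANOUT row 21 (`su3-base`).  The row's measurement card states
the scored charge in two normalisations at once — "`Q_clov = −(1/4π²) Σ_x [tr G₀₁G₂₃ − tr G₀₂G₁₃ + tr G₀₃G₁₂]
(= −(1/32π²) Σ ε_{μνρσ} tr G_{μν} G_{ρσ})`" (HOME/su3-base/CARD-su3-base.md §3) — and the Literature's
`cloverPseudoscalar` (`P_x = −2 Re tr(C₀₁C₂₃ − C₀₂C₁₃ + C₀₃C₁₂)`) records in its docstring the same identity with the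
Levi-Civita form `−¼ ε_{μνρσ} Re tr(C_{μν}C_{ρσ})` without a proof term.  This file is the finite algebra behind the factor
`8 = 32/4`: OUR WORK over Mathlib (the signed sum over `Equiv.Perm (Fin 4)` IS the Levi-Civita contraction — `ε` vanishes off
permutations — so no `ε` symbol needs to be defined) and the Literature's `flowedClover_swap` (`C_{νμ} = −C_{μν}` for unitary
`ρ`); def-free; nothing cited as a fact; no number of ours.

* §1 **`sum_perm_sign_fin_four_of_antisymm`** — for every `T : Fin 4 → Fin 4 → Fin 4 → Fin 4 → R` (`R` a commutative ring)
  antisymmetric in its first pair and in its second pair and symmetric under the exchange of the two pairs,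
  `Σ_{σ ∈ S₄} sgn(σ) T(σ0, σ1, σ2, σ3) = 8·(T 0 1 2 3 − T 0 2 1 3 + T 0 3 1 2)` (the 24 signed terms collapse to 3, eight each:
  `2·2` pair flips × `2` pair exchanges).
* §2 **`sum_perm_sign_re_trace_mul_of_antisymm`** — for an antisymmetric family of square complex matrices
  `C_{νμ} = −C_{μν}`: `Σ_σ sgn(σ) Re tr(C_{σ0σ1} C_{σ2σ3}) = 8·(Re tr(C₀₁C₂₃) − Re tr(C₀₂C₁₃) + Re tr(C₀₃C₁₂))`.
* §3 THE CLOVER (any group `G`, unitary matrix representation `ρ`, any site type, FLOW TIME `t` arbitrary for the contraction,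
  `t = 0` for `P`): **`cloverPseudoscalar_eq_leviCivita`** — `P_x = −¼ Σ_σ sgn(σ) Re tr(C_{σ0σ1}C_{σ2σ3})` with
  `C_{μν} = flowedClover ρ 0 U x μ ν`; **`cloverCharge_normalisations_agree`** —
  `−(1/(32π²)) Σ_σ sgn(σ) Re tr(C_{σ0σ1}C_{σ2σ3}) = −(1/(4π²))·(Re tr C₀₁C₂₃ − Re tr C₀₂C₁₃ + Re tr C₀₃C₁₂) = P_x/(8π²)`:
  the two printed normalisations of the card are the same number, and it is the Literature density over `8π²`.
NOT CLAIMED: anything about `O(a²)` improvement, the sign convention of `Q`, or the flowed/cooled field beyond the pointwise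
algebra (the identity holds configuration by configuration at every flow time).
-/

namespace Summit.Ventures.LatticeQCDFlow.Scoring

open Equiv Matrix
open Literature.MathematicalPhysics.QuantumLattice (flowedClover flowedClover_swap cloverPseudoscalar)

/-! ## §1 The signed sum over `S₄` of a doubly antisymmetric tensor -/

/-- **`Σ_{σ ∈ S₄} sgn(σ) T(σ0,σ1,σ2,σ3) = 8·(T 0 1 2 3 − T 0 2 1 3 + T 0 3 1 2)`** for `T` antisymmetric in the first and in the
second index pair and symmetric under the exchange of the pairs (the Levi-Civita contraction of a symmetric pairing of two
antisymmetric tensors). -/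
theorem sum_perm_sign_fin_four_of_antisymm {R : Type*} [CommRing R] (T : Fin 4 → Fin 4 → Fin 4 → Fin 4 → R)
    (h1 : ∀ a b c d, T b a c d = -T a b c d) (h2 : ∀ c d a b, T a b d c = -T a b c d)
    (h3 : ∀ a b c d, T c d a b = T a b c d) :
    ∑ σ : Perm (Fin 4), ((Perm.sign σ : ℤ) : R) * T (σ 0) (σ 1) (σ 2) (σ 3) =
      8 * (T 0 1 2 3 - T 0 2 1 3 + T 0 3 1 2) := by
  -- evaluation of `decomposeFin.symm` on the literals of `Fin 4`, `Fin 3`, `Fin 2`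
  have a1 : ∀ (p : Fin 4) (e : Perm (Fin 3)), Perm.decomposeFin.symm (p, e) 1 = swap 0 p (e 0).succ :=
    fun p e => Perm.decomposeFin_symm_apply_succ e p 0
  have a2 : ∀ (p : Fin 4) (e : Perm (Fin 3)), Perm.decomposeFin.symm (p, e) 2 = swap 0 p (e 1).succ :=
    fun p e => Perm.decomposeFin_symm_apply_succ e p 1
  have a3 : ∀ (p : Fin 4) (e : Perm (Fin 3)), Perm.decomposeFin.symm (p, e) 3 = swap 0 p (e 2).succ :=
    fun p e => Perm.decomposeFin_symm_apply_succ e p 2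
  have b1 : ∀ (p : Fin 3) (e : Perm (Fin 2)), Perm.decomposeFin.symm (p, e) 1 = swap 0 p (e 0).succ :=
    fun p e => Perm.decomposeFin_symm_apply_succ e p 0
  have b2 : ∀ (p : Fin 3) (e : Perm (Fin 2)), Perm.decomposeFin.symm (p, e) 2 = swap 0 p (e 1).succ :=
    fun p e => Perm.decomposeFin_symm_apply_succ e p 1
  have c1 : ∀ (p : Fin 2) (e : Perm (Fin 1)), Perm.decomposeFin.symm (p, e) 1 = swap 0 p (e 0).succ :=
    fun p e => Perm.decomposeFin_symm_apply_succ e p 0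
  have e3 : (Fin.succ (2 : Fin 3) : Fin 4) = 3 := rfl
  -- expand the sum over `S₄ = Fin 4 × (Fin 3 × (Fin 2 × S₁))`
  simp only [Finset.univ_perm_fin_succ, Finset.sum_map, ← Finset.univ_product_univ, Finset.sum_product,
    Fin.sum_univ_succ, Finset.univ_unique, Finset.sum_singleton]
  simp only [Equiv.toEmbedding_apply, Equiv.Perm.decomposeFin.symm_sign, Equiv.Perm.decomposeFin_symm_apply_zero,
    a1, a2, a3, b1, b2, c1]
  simp (config := {decide := true}) only [Equiv.swap_apply_def, if_true, if_false, Fin.succ_zero_eq_one,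
    Fin.succ_one_eq_two, e3, Equiv.Perm.default_eq, Equiv.Perm.sign_one, Fin.default_eq_zero, Units.val_one,
    Units.val_neg, Int.cast_one, Int.cast_neg, mul_one, one_mul, neg_neg, mul_neg, neg_mul, Equiv.Perm.coe_one, id_eq]
  -- bring every term to increasing index pairs
  simp only [h1 0 1, h1 0 2, h1 0 3, h1 1 2, h1 1 3, h1 2 3, h2 0 1, h2 0 2, h2 0 3, h2 1 2, h2 1 3, h2 2 3]
  simp only [h3 0 3 1 2, h3 0 2 1 3, h3 0 1 2 3]
  ring

/-! ## §2 Antisymmetric families of matrices -/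

/-- **`Σ_σ sgn(σ) Re tr(C_{σ0σ1} C_{σ2σ3}) = 8·(Re tr(C₀₁C₂₃) − Re tr(C₀₂C₁₃) + Re tr(C₀₃C₁₂))`** for an antisymmetric family
`C_{νμ} = −C_{μν}` of square complex matrices. -/
theorem sum_perm_sign_re_trace_mul_of_antisymm {n : Type*} [Fintype n] [DecidableEq n]
    (C : Fin 4 → Fin 4 → Matrix n n ℂ) (hC : ∀ μ ν, C ν μ = -C μ ν) :
    ∑ σ : Perm (Fin 4), ((Perm.sign σ : ℤ) : ℝ) * (C (σ 0) (σ 1) * C (σ 2) (σ 3)).trace.re =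
      8 * ((C 0 1 * C 2 3).trace.re - (C 0 2 * C 1 3).trace.re + (C 0 3 * C 1 2).trace.re) :=
  sum_perm_sign_fin_four_of_antisymm (fun a b c d => (C a b * C c d).trace.re)
    (fun a b c d => by simp only [hC a b, Matrix.neg_mul, trace_neg, Complex.neg_re])
    (fun c d a b => by simp only [hC c d, Matrix.mul_neg, trace_neg, Complex.neg_re])
    (fun a b c d => by rw [Matrix.trace_mul_comm])

/-! ## §3 The clover -/

section Clover

variable {R : Type*} [AddCommGroup R] [One R] {N : ℕ} {G : Type*} [Group G] (ρ : G →* Matrix (Fin N) (Fin N) ℂ)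

/-- The Levi-Civita contraction of Lüscher's clover field tensor at any flow time `t`:
`Σ_σ sgn(σ) Re tr(C_{σ0σ1}C_{σ2σ3}) = 8·(Re tr C₀₁C₂₃ − Re tr C₀₂C₁₃ + Re tr C₀₃C₁₂)`, `C_{μν} = flowedClover ρ t U x μ ν`
(unitary `ρ`, so `C_{νμ} = −C_{μν}`). -/
theorem sum_perm_sign_re_trace_flowedClover (hρ : ∀ g, ρ g ∈ Matrix.unitaryGroup (Fin N) ℂ) (t : ℝ)
    (U : (Fin 4 → R) × Fin 4 → G) (x : Fin 4 → R) :
    ∑ σ : Perm (Fin 4), ((Perm.sign σ : ℤ) : ℝ) *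
        (flowedClover ρ t U x (σ 0) (σ 1) * flowedClover ρ t U x (σ 2) (σ 3)).trace.re =
      8 * ((flowedClover ρ t U x 0 1 * flowedClover ρ t U x 2 3).trace.re -
        (flowedClover ρ t U x 0 2 * flowedClover ρ t U x 1 3).trace.re +
        (flowedClover ρ t U x 0 3 * flowedClover ρ t U x 1 2).trace.re) :=
  sum_perm_sign_re_trace_mul_of_antisymm (fun μ ν => flowedClover ρ t U x μ ν) fun μ ν => flowedClover_swap ρ hρ t U x μ ν

/-- **THE LEVI-CIVITA FORM OF THE CLOVER CHARGE DENSITY: `P_x = −¼ Σ_σ sgn(σ) Re tr(C_{σ0σ1} C_{σ2σ3})`** with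
`C_{μν} = flowedClover ρ 0 U x μ ν` (unitary `ρ`) — the identity recorded in the docstring of the Literature's
`cloverPseudoscalar`. -/
theorem cloverPseudoscalar_eq_leviCivita (hρ : ∀ g, ρ g ∈ Matrix.unitaryGroup (Fin N) ℂ)
    (U : (Fin 4 → R) × Fin 4 → G) (x : Fin 4 → R) :
    cloverPseudoscalar ρ x U = -(1 / 4 : ℝ) * ∑ σ : Perm (Fin 4), ((Perm.sign σ : ℤ) : ℝ) *
        (flowedClover ρ 0 U x (σ 0) (σ 1) * flowedClover ρ 0 U x (σ 2) (σ 3)).trace.re := by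
  rw [sum_perm_sign_re_trace_flowedClover ρ hρ 0 U x, Literature.MathematicalPhysics.QuantumLattice.cloverPseudoscalar_def]
  simp only [trace_sub, trace_add, Complex.sub_re, Complex.add_re]
  ring

/-- **THE TWO PRINTED NORMALISATIONS AGREE AND ARE THE LITERATURE DENSITY OVER `8π²`**:
`−(1/(32π²)) Σ_σ sgn(σ) Re tr(C_{σ0σ1}C_{σ2σ3}) = −(1/(4π²))·(Re tr C₀₁C₂₃ − Re tr C₀₂C₁₃ + Re tr C₀₃C₁₂) = P_x/(8π²)`. -/
theorem cloverCharge_normalisations_agree (hρ : ∀ g, ρ g ∈ Matrix.unitaryGroup (Fin N) ℂ)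
    (U : (Fin 4 → R) × Fin 4 → G) (x : Fin 4 → R) :
    -(1 / (32 * Real.pi ^ 2)) * ∑ σ : Perm (Fin 4), ((Perm.sign σ : ℤ) : ℝ) *
          (flowedClover ρ 0 U x (σ 0) (σ 1) * flowedClover ρ 0 U x (σ 2) (σ 3)).trace.re =
        -(1 / (4 * Real.pi ^ 2)) * ((flowedClover ρ 0 U x 0 1 * flowedClover ρ 0 U x 2 3).trace.re -
          (flowedClover ρ 0 U x 0 2 * flowedClover ρ 0 U x 1 3).trace.re +
          (flowedClover ρ 0 U x 0 3 * flowedClover ρ 0 U x 1 2).trace.re) ∧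
      -(1 / (32 * Real.pi ^ 2)) * ∑ σ : Perm (Fin 4), ((Perm.sign σ : ℤ) : ℝ) *
          (flowedClover ρ 0 U x (σ 0) (σ 1) * flowedClover ρ 0 U x (σ 2) (σ 3)).trace.re =
        cloverPseudoscalar ρ x U / (8 * Real.pi ^ 2) := by
  have hπ : Real.pi ^ 2 ≠ 0 := pow_ne_zero 2 Real.pi_ne_zero
  constructor
  · rw [sum_perm_sign_re_trace_flowedClover ρ hρ 0 U x]
    field_simp
    ring
  · rw [cloverPseudoscalar_eq_leviCivita ρ hρ U x]
    field_simp
    ring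

end Clover

end Summit.Ventures.LatticeQCDFlow.Scoring
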